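import Summits.QuantumFields.YangMills.Theorems.BalabanUVNodesN07SeamWitnessWalks
import HarnessLib

/-!
# N07 [B11] ∕ K0⁷ chart road — THE SEAM WITNESS, part A′: `exp[mean log] = 1` for an antisymmetric family, and `Ū(c⋆) = 1` for the antisymmetric
# two-connector twist of one block interface

Cell `pub-ymgap`, seat `pub-ymgap-dag-n07-w3` g15 (WIDTH SEAT 3 on N07).  `--kind proof --supports stmt-QuantumFields-20541 --as helper` (K0⁷; count-neutral;
NEGATIVE-SIDE helper).  [I] = [Balaban1987RG1]; [B7] = [Balaban1985Averaging].

WHY (continuation of part A `…N07SeamWitnessWalks`, the series that TYPES the counter-model to the K0⁷ chart road's displayed premise HSEAM — director-ym №335 (B),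
dag-n07-e `LOCATE-HSEAM` (γ) — WITHOUT any minimiser).  The print-admissible curve of the witness twists TWO parallel inward connectors of one block face by
`g(t)` and `g(t)⁻¹`; this file shows that Bałaban's (0.4) average of record `blockAvg expMeanLogSU` does not see that twist at the crossed coarse bond `c⋆`:
§5 for the printed inner operation `exp[i Σ_i |I|⁻¹ (1/i) log W_i]` on `SU(N)` (`ExpMeanLog.expMeanLogSU`), a loop family with values in `{1, g, g⁻¹}`
(`|g − 1| < δ_N`) carried to its pointwise inverse by a bijection of the index set has `Σ_i log W_i = −Σ_i log W_i = 0` (oddness of the series logarithm on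
unitaries near `1`, `ExpMeanLog.mlog_eq_neg_of_mul_eq_one`), hence average EXACTLY `1`; §6 at `c⋆ = ⟨y₁, μ₀⟩`, for two interface bonds at transverse offsets
`ρ ≠ ρ′` (exchanged by `r_{κ₂} ↦ swap(ρ_{κ₂}, ρ′_{κ₂})`, both off the central axis) carrying `g`, `g⁻¹`: the loop family is `g` on the `ρ`-axis indices, `g⁻¹` on
the `ρ′`-axis indices, `1` elsewhere (part A §3–§4), so the correction factor is `1`, the straight transporter is `1`, and `Ū(c⋆) = 1`.

HONEST FRAMING: kernel bookkeeping about the tree's averaging (an exact identity, no estimate); nothing of Bałaban [I]∕[B7] asserted or refuted; used ONLY by parts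
B–C to certify that HSEAM AS DISPLAYED is uninhabited; it does not bear on (E1)∕(E3); K0⁷ stub 1 NOT closed; N05 ∕ N07 NOT discharged; counts unmoved (typed 28∕28 ·
discharged 8∕28); one finite 𝕋⁴ programme at fixed ε — R4 closes the conditional finite-𝕋⁴ rung `BalabanLadder.UV` only; the YM mass gap (Clay) is NOT proved by
any of this; nothing continuum ∕ ℝ⁴ ∕ OS.  No `def`, no `instance`, no `notation`, no `sorry`.

References: [I] (0.3)–(0.7) pp. 252–253; [B7] (8)–(11) p. 19, (26) p. 23.
-/

set_option autoImplicit false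

noncomputable section

open scoped Matrix.Norms.L2Operator BigOperators

namespace Summit.QuantumFields.YangMills.BalabanUVNodes.N07SeamWitness

open Literature.MathematicalPhysics.QuantumFieldTheory.Balaban1983to89
open Literature.MathematicalPhysics.QuantumFieldTheory.Balaban1983to89.T4Continuum
open BlockAveraging

/-! ## §5  `exp[mean log] = 1` for a family taking the values `g`, `g⁻¹` on index sets exchanged by an involution, `1` elsewhere -/
section EML

open ExpMeanLog (eml deltaSU expMeanLogSU deltaSU_pos lt_third_of_lt_deltaSU mlog_eq_neg_of_mul_eq_one eml_eq_exp)
open BlockAveragingEMLAnalyticMean (coe_expMeanLogSU_E_eq_eml)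
open MatrixLog (mlog mlog_one)

variable {N : ℕ} [NeZero N]

/-- **THE PRINTED INNER AVERAGE OF AN ANTISYMMETRIC FAMILY IS EXACTLY `1`.**  For the printed operation `exp[i Σ_i |I|⁻¹ (1/i) log W_i]` of [I] (0.4) on `SU(N)`
(`ExpMeanLog.expMeanLogSU`): if every `W_i ∈ {1, g, g⁻¹}` with `|g − 1| < δ_N`, and a bijection `σ` of the index set carries `W` to its pointwise inverse
(`W_{σ i} = W_i⁻¹`), then `Σ_i log W_i = Σ_i log W_{σ i} = −Σ_i log W_i` (the series logarithm is odd on unitaries near `1`: `ExpMeanLog.mlog_eq_neg_of_mul_eq_one`),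
so the exponent vanishes and the average is `exp 0 = 1` — no estimate, an identity. [cite: Balaban1987RG1, (0.4)–(0.5) p.253 (bookkeeping)] -/
theorem avg_expMeanLogSU_eq_one_of_involutive {ι : Type*} [Fintype ι] [Nonempty ι] (W : ι → Matrix.specialUnitaryGroup (Fin N) ℂ)
    (g : Matrix.specialUnitaryGroup (Fin N) ℂ) (hg : dist1 g < deltaSU (Fin N)) (hW : ∀ i, W i = 1 ∨ W i = g ∨ W i = g⁻¹)
    (σ : ι ≃ ι) (hσ : ∀ i, W (σ i) = (W i)⁻¹) :
    (expMeanLogSU (n := Fin N)).avg W = 1 := by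
  classical
  have hsm : ∀ i, dist1 (W i) < deltaSU (Fin N) := by
    intro i
    rcases hW i with h | h | h
    · rw [h, GaugeGroup.dist1_one]; exact deltaSU_pos
    · rw [h]; exact hg
    · rw [h, GaugeGroup.dist1_inv]; exact hg
  set e := LoopAverage.enum ι with he
  set V : Fin (Fintype.card ι - 1 + 1) → Matrix.specialUnitaryGroup (Fin N) ℂ := W ∘ e.symm with hV
  have hsmV : ∀ k, dist1 (V k) < deltaSU (Fin N) := fun k => hsm _
  show (expMeanLogSU (n := Fin N)).E V = 1
  apply Subtype.ext
  rw [coe_expMeanLogSU_E_eq_eml V hsmV, eml_eq_exp]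
  -- the sum of the logarithms vanishes
  have hsum0 : ∑ i, mlog ((W i : Matrix.specialUnitaryGroup (Fin N) ℂ) : Matrix (Fin N) (Fin N) ℂ) = 0 := by
    set T := ∑ i, mlog ((W i : Matrix.specialUnitaryGroup (Fin N) ℂ) : Matrix (Fin N) (Fin N) ℂ) with hT
    -- `T = Σ_i log W_{σ i} = Σ_i log W_i⁻¹ = −T`
    have hneg : ∀ i, mlog ((((W i)⁻¹ : Matrix.specialUnitaryGroup (Fin N) ℂ)) : Matrix (Fin N) (Fin N) ℂ) =
        -mlog ((W i : Matrix.specialUnitaryGroup (Fin N) ℂ) : Matrix (Fin N) (Fin N) ℂ) := by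
      intro i
      refine mlog_eq_neg_of_mul_eq_one ?_ (lt_third_of_lt_deltaSU (hsm i)).le
      exact Unitary.mul_star_self_of_mem (Matrix.mem_specialUnitaryGroup_iff.1 (W i).2).1
    have h1 : T = ∑ i, mlog (((W (σ i)) : Matrix.specialUnitaryGroup (Fin N) ℂ) : Matrix (Fin N) (Fin N) ℂ) :=
      (Equiv.sum_comp σ (fun i => mlog ((W i : Matrix.specialUnitaryGroup (Fin N) ℂ) : Matrix (Fin N) (Fin N) ℂ))).symm
    have h2 : T = -T := by
      nth_rewrite 1 [h1]
      rw [show (fun i => mlog (((W (σ i)) : Matrix.specialUnitaryGroup (Fin N) ℂ) : Matrix (Fin N) (Fin N) ℂ)) =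
        fun i => -mlog ((W i : Matrix.specialUnitaryGroup (Fin N) ℂ) : Matrix (Fin N) (Fin N) ℂ) from funext fun i => by rw [hσ i, hneg i],
        Finset.sum_neg_distrib]
    have h3 : (2 : ℂ) • T = 0 := by rw [two_smul]; nth_rewrite 2 [h2]; exact add_neg_cancel T
    exact (smul_eq_zero.mp h3).resolve_left two_ne_zero
  have hre : ∑ k, mlog ((V k : Matrix.specialUnitaryGroup (Fin N) ℂ) : Matrix (Fin N) (Fin N) ℂ) =
      ∑ i, mlog ((W i : Matrix.specialUnitaryGroup (Fin N) ℂ) : Matrix (Fin N) (Fin N) ℂ) :=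
    e.symm.sum_comp (fun i => mlog ((W i : Matrix.specialUnitaryGroup (Fin N) ℂ) : Matrix (Fin N) (Fin N) ℂ))
  rw [hre, hsum0, smul_zero, NormedSpace.exp_zero]
  rfl

end EML

/-! ## §6  `Ū(c⋆) = 1` for the antisymmetric two-connector twist `(g at offset ρ, g⁻¹ at offset ρ′)` of one block interface -/
section TwoBond

open ExpMeanLog (deltaSU expMeanLogSU)

variable {P : Params} {j : ℕ} {N : ℕ} [NeZero N]

/-- **THE AVERAGING OF RECORD RETURNS `1` AT `c⋆` ON THE ANTISYMMETRIC TWO-CONNECTOR TWIST.**  Two bonds of the interface `B(y₁) | B(y₁ + e_{μ₀})`, at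
transverse offsets `ρ ≠ ρ′` (both off the central axis in some transverse coordinate, and differing in the transverse coordinate `κ₂` where the involution
`r_{κ₂} ↦ swap(ρ_{κ₂}, ρ′_{κ₂})` of the index set exchanges their axes, agreeing elsewhere), carry `g` and `g⁻¹` (`|g − 1| < δ_N`), every other bond `1`.  Then
at `c⋆ = ⟨y₁, μ₀⟩`: the (0.4) loop family is `g` on the `ρ`-axis indices, `g⁻¹` on the `ρ′`-axis indices, `1` elsewhere (§3 product of the two single twists, §4),
its printed inner average is `1` (§5), the straight transporter is `1`, so `Ū(c⋆) = 1` for `blockAvg expMeanLogSU`. [cite: Balaban1987RG1, (0.4) p.253 (bookkeeping)] -/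
theorem avgFun_twoBond_star_eq_one (hper : 2 * P.L < P.sitesPerDir j) (hL : 3 ≤ P.L) {κ₁ κ₂ μ0 : Fin P.d} (hκ₁ : κ₁ ≠ μ0) (hκ₂ : κ₂ ≠ μ0)
    (y₁ : Site P (j + 1)) (x' x'' : Site P j) (g : Matrix.specialUnitaryGroup (Fin N) ℂ) (hg : dist1 g < deltaSU (Fin N))
    (ρ ρ' : Fin P.d → ℕ) (hρL : ∀ κ, ρ κ < P.L) (hρ'L : ∀ κ, ρ' κ < P.L) (hρκ₁ : ρ κ₁ ≠ (P.L - 1) / 2) (hρ'κ₁ : ρ' κ₁ ≠ (P.L - 1) / 2)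
    (hρρ' : ρ κ₂ ≠ ρ' κ₂) (hagree : ∀ κ, κ ≠ κ₂ → ρ κ = ρ' κ)
    (hx0 : x' μ0 = emb y₁ μ0 + (((P.L - 1) / 2 : ℕ) : ZMod (P.sitesPerDir j)))
    (hxκ : ∀ κ, κ ≠ μ0 → x' κ + (((P.L - 1) / 2 : ℕ) : ZMod (P.sitesPerDir j)) = emb y₁ κ + ((ρ κ : ℕ) : ZMod (P.sitesPerDir j)))
    (hx0' : x'' μ0 = emb y₁ μ0 + (((P.L - 1) / 2 : ℕ) : ZMod (P.sitesPerDir j)))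
    (hxκ' : ∀ κ, κ ≠ μ0 → x'' κ + (((P.L - 1) / 2 : ℕ) : ZMod (P.sitesPerDir j)) = emb y₁ κ + ((ρ' κ : ℕ) : ZMod (P.sitesPerDir j))) :
    avgFun (expMeanLogSU (n := Fin N))
      (fun b : PBond P j => (if b.src = x' ∧ b.dir = μ0 then g else 1) * (if b.src = x'' ∧ b.dir = μ0 then g⁻¹ else 1)) ⟨y₁, μ0⟩ = 1 := by
  classical
  set VA : GaugeField P j (Matrix.specialUnitaryGroup (Fin N) ℂ) := fun b => if b.src = x' ∧ b.dir = μ0 then g else 1 with hVA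
  set VB : GaugeField P j (Matrix.specialUnitaryGroup (Fin N) ℂ) := fun b => if b.src = x'' ∧ b.dir = μ0 then g⁻¹ else 1 with hVB
  have hcomm : ∀ b b', VA b * VB b' = VB b' * VA b := by
    intro b b'
    simp only [hVA, hVB]
    split_ifs <;> simp
  -- the loop family at `c⋆`
  have hA : ∀ i : Idx P, loopHol VA ⟨y₁, μ0⟩ i = if (∀ κ, κ ≠ μ0 → (i.1 κ : ℕ) = ρ κ) then g else 1 :=
    fun i => loopHol_single_offset_star hper hL hκ₁ y₁ x' g ρ hρL hρκ₁ hx0 hxκ i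
  have hB : ∀ i : Idx P, loopHol VB ⟨y₁, μ0⟩ i = if (∀ κ, κ ≠ μ0 → (i.1 κ : ℕ) = ρ' κ) then g⁻¹ else 1 :=
    fun i => loopHol_single_offset_star hper hL hκ₁ y₁ x'' g⁻¹ ρ' hρ'L hρ'κ₁ hx0' hxκ' i
  have hl : ∀ i : Idx P, loopHol (fun b => VA b * VB b) ⟨y₁, μ0⟩ i =
      (if (∀ κ, κ ≠ μ0 → (i.1 κ : ℕ) = ρ κ) then g else 1) * (if (∀ κ, κ ≠ μ0 → (i.1 κ : ℕ) = ρ' κ) then g⁻¹ else 1) := by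
    intro i; rw [loopHol_mul_of_commute VA VB hcomm, hA, hB]
  -- the two axes are disjoint
  have hdisj : ∀ r : Fin P.d → Fin P.L, (∀ κ, κ ≠ μ0 → (r κ : ℕ) = ρ κ) → ¬ (∀ κ, κ ≠ μ0 → (r κ : ℕ) = ρ' κ) :=
    fun r h h' => hρρ' ((h κ₂ hκ₂).symm.trans (h' κ₂ hκ₂))
  -- the involution of the index set: swap the values `ρ κ₂ ↔ ρ′ κ₂` of the `κ₂`-th offset
  set a : Fin P.L := ⟨ρ κ₂, hρL κ₂⟩ with ha
  set a' : Fin P.L := ⟨ρ' κ₂, hρ'L κ₂⟩ with ha'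
  set τ : (Fin P.d → Fin P.L) ≃ (Fin P.d → Fin P.L) :=
    { toFun := fun r => Function.update r κ₂ (Equiv.swap a a' (r κ₂))
      invFun := fun r => Function.update r κ₂ (Equiv.swap a a' (r κ₂))
      left_inv := fun r => by
        funext κ
        by_cases hκ : κ = κ₂
        · subst hκ; simp [Equiv.swap_apply_self]
        · simp [Function.update_of_ne hκ]
      right_inv := fun r => by
        funext κ
        by_cases hκ : κ = κ₂
        · subst hκ; simp [Equiv.swap_apply_self]
        · simp [Function.update_of_ne hκ] } with hτ
  set σI : Idx P ≃ Idx P := Equiv.prodCongr τ (Equiv.refl _) with hσI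
  have hτκ₂ : ∀ r : Fin P.d → Fin P.L, (τ r) κ₂ = Equiv.swap a a' (r κ₂) := fun r => by simp [hτ]
  have hτne : ∀ (r : Fin P.d → Fin P.L) κ, κ ≠ κ₂ → (τ r) κ = r κ := fun r κ hκ => by simp [hτ, Function.update_of_ne hκ]
  -- axis membership under the involution
  have honA : ∀ r : Fin P.d → Fin P.L, (∀ κ, κ ≠ μ0 → ((τ r) κ : ℕ) = ρ κ) ↔ (∀ κ, κ ≠ μ0 → (r κ : ℕ) = ρ' κ) := by
    intro r
    constructor
    · intro h κ hκ
      by_cases hk : κ = κ₂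
      · rw [hk]
        have h2 := h κ₂ hκ₂
        rw [hτκ₂] at h2
        have hs : Equiv.swap a a' (r κ₂) = a := Fin.ext h2
        rw [Equiv.swap_apply_eq_iff, Equiv.swap_apply_left] at hs
        rw [hs]
      · rw [← hagree κ hk, ← hτne r κ hk]; exact h κ hκ
    · intro h κ hκ
      by_cases hk : κ = κ₂
      · rw [hk, hτκ₂]
        have h2 : r κ₂ = a' := Fin.ext (h κ₂ hκ₂)
        rw [h2, Equiv.swap_apply_right]
      · rw [hτne r κ hk, hagree κ hk]; exact h κ hκ
  have honB : ∀ r : Fin P.d → Fin P.L, (∀ κ, κ ≠ μ0 → ((τ r) κ : ℕ) = ρ' κ) ↔ (∀ κ, κ ≠ μ0 → (r κ : ℕ) = ρ κ) := by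
    intro r
    have := honA (τ r)
    have hττ : τ (τ r) = r := τ.left_inv r
    rw [hττ] at this
    exact this.symm
  -- the family, its values and its antisymmetry
  set W : Idx P → Matrix.specialUnitaryGroup (Fin N) ℂ := loopHol (fun b => VA b * VB b) ⟨y₁, μ0⟩ with hWdef
  have hWval : ∀ i, W i = 1 ∨ W i = g ∨ W i = g⁻¹ := by
    intro i
    rw [hl i]
    by_cases h1 : ∀ κ, κ ≠ μ0 → (i.1 κ : ℕ) = ρ κ
    · rw [if_pos h1, if_neg (hdisj i.1 h1), mul_one]; exact Or.inr (Or.inl rfl)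
    · rw [if_neg h1, one_mul]
      by_cases h2 : ∀ κ, κ ≠ μ0 → (i.1 κ : ℕ) = ρ' κ
      · rw [if_pos h2]; exact Or.inr (Or.inr rfl)
      · rw [if_neg h2]; exact Or.inl rfl
  have hWσ : ∀ i, W (σI i) = (W i)⁻¹ := by
    rintro ⟨r, s, s'⟩
    have e1 : σI (r, s, s') = (τ r, s, s') := rfl
    rw [e1, hl, hl]
    dsimp only
    by_cases h1 : ∀ κ, κ ≠ μ0 → (r κ : ℕ) = ρ κ
    · have h1' : ∀ κ, κ ≠ μ0 → ((τ r) κ : ℕ) = ρ' κ := (honB r).2 h1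
      have h2 : ¬ ∀ κ, κ ≠ μ0 → (r κ : ℕ) = ρ' κ := hdisj r h1
      have h2' : ¬ ∀ κ, κ ≠ μ0 → ((τ r) κ : ℕ) = ρ κ := fun h => h2 ((honA r).1 h)
      rw [if_neg h2', if_pos h1', if_pos h1, if_neg h2]; simp
    · by_cases h2 : ∀ κ, κ ≠ μ0 → (r κ : ℕ) = ρ' κ
      · have h2' : ∀ κ, κ ≠ μ0 → ((τ r) κ : ℕ) = ρ κ := (honA r).2 h2
        have h1' : ¬ ∀ κ, κ ≠ μ0 → ((τ r) κ : ℕ) = ρ' κ := fun h => h1 ((honB r).1 h)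
        rw [if_pos h2', if_neg h1', if_neg h1, if_pos h2]; simp
      · have h1' : ¬ ∀ κ, κ ≠ μ0 → ((τ r) κ : ℕ) = ρ' κ := fun h => h1 ((honB r).1 h)
        have h2' : ¬ ∀ κ, κ ≠ μ0 → ((τ r) κ : ℕ) = ρ κ := fun h => h2 ((honA r).1 h)
        rw [if_neg h2', if_neg h1', if_neg h1, if_neg h2]; simp
  have havg : (expMeanLogSU (n := Fin N)).avg W = 1 := avg_expMeanLogSU_eq_one_of_involutive W g hg hWval σI hWσ
  have hsmall : BlockAveraging.Small (expMeanLogSU (n := Fin N)) (fun b => VA b * VB b) ⟨y₁, μ0⟩ := by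
    intro i
    show dist1 (W i) < _
    rcases hWval i with h | h | h
    · rw [h, GaugeGroup.dist1_one]; exact (expMeanLogSU (n := Fin N)).δ_pos
    · rw [h]; exact hg
    · rw [h, GaugeGroup.dist1_inv]; exact hg
  -- the straight transporter
  have hax : AveragingRT.axialAvg (fun b => VA b * VB b) ⟨y₁, μ0⟩ = 1 := by
    rw [axialAvg_mul_of_commute VA VB hcomm, axialAvg_single_offset_star hper hL hκ₁ y₁ x' g ρ hρL hρκ₁ hxκ,
      axialAvg_single_offset_star hper hL hκ₁ y₁ x'' g⁻¹ ρ' hρ'L hρ'κ₁ hxκ', mul_one]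
  show corr (expMeanLogSU (n := Fin N)) (fun b => VA b * VB b) ⟨y₁, μ0⟩ * AveragingRT.axialAvg (fun b => VA b * VB b) ⟨y₁, μ0⟩ = 1
  rw [hax, mul_one, corr, if_pos hsmall]
  exact havg

end TwoBond

end Summit.QuantumFields.YangMills.BalabanUVNodes.N07SeamWitness

end
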